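import Mathlib.Topology.Sets.Opens
import Mathlib.Topology.Sets.Closeds
import Mathlib.Topology.Sober
import Mathlib.Topology.Connected.LocallyConnected
import Mathlib.Topology.Homeomorph.Lemmas
import Mathlib.Topology.Sheaves.Sheaf
import Mathlib.CategoryTheory.Category.Preorder
import Mathlib.CategoryTheory.Limits.FormalCoproducts.Basic
import Mathlib.CategoryTheory.ObjectProperty.FullSubcategory
import Mathlib.CategoryTheory.Yoneda
import Literature.AlgebraicGeometry.Frobenioids.Categories
import HarnessLib

/-!
# Frobenioids II, Appendix: categorical representation of topological spaces

Mochizuki, *The geometry of Frobenioids II*, Kyushu J. Math. **62** (2008) 401–460, Appendix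
"Categorical Representation of Topological Spaces", author's text pp. 66–68: the categories
`Subset(X) ⊇ Open(X), Closed(X)`, `Open⁰(X)`, `Shv(X)`, Definition A.1 (i)–(iii), Remark A.1.1,
Theorem A.2 (i)–(vi), Remark A.2.1 [cite: MochizukiFrdII2008, Appendix pp.66-68]. Theorem A.2 (vi)
is what [FrdII] Theorem 3.6 (vii) uses to recover the topological space `∂A_A` from the category
`Open⁰(∂A_A)`.

**Dictionary.** `Subset(X)` = the preorder category of `Set X`; `Open(X)` = Mathlib
`TopologicalSpace.Opens X`, `Closed(X)` = `TopologicalSpace.Closeds X` (as preorder categories;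
equivalent to the printed full subcategories of `Subset(X)`); `Open⁰(X)` = the full subcategory of
`Opens X` on nonempty connected opens; `Shv(X)` = `TopCat.Sheaf (Type u) (TopCat.of X)`;
"locally connected" = Mathlib `LocallyConnectedSpace` (proved equivalent to the printed wording,
`isLocallyConnected_iff_locallyConnectedSpace`); "sober" (∃! generic point) = `QuasiSober ∧ T0Space` (proved,
`isSober_iff_quasiSober`); `Disjt(Open⁰(X))` = the full subcategory of Mathlib's `FormalCoproduct (Open⁰ X)`
on collections of disjoint objects (its arrows are literally the printed "function `f : I → J` and
arrows `Uᵢ → V_{f(i)}`").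

**Contents.** Def. A.1 (i)–(iii) defined; Rmk A.1.1 PROVED; the functors
`Open⁰(X) → Disjt(Open⁰(X)) → Open(X)`; Thm A.2 (i) PROVED (complement), (ii) PROVED (categories with
subsingleton hom-sets are slim), (iii) the Yoneda part is Mathlib, the sheaf part is a named fact,
(iv)–(vi) named facts quoting print ("considered up to isomorphism" is rendered on objects: in these
partially ordered categories isomorphic functors agree on objects); Rmk A.2.1 (soberness and local
connectedness are independent) as two named facts. No statement is strengthened.
-/

namespace Literature.AlgebraicGeometry.Frobenioids

open CategoryTheory Topology TopologicalSpace Set Function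

universe u

namespace TopRep

variable (X : Type u) [TopologicalSpace X]

/-! ### The categories (p. 66) -/

/-- `Subset(X)`: subsets of `X` and inclusions (FrdII App. p. 66) — the preorder category of `Set X`.
[cite: MochizukiFrdII2008, Appendix p.66] -/
abbrev SubsetCat : Type u := Set X

/-- `Open(X) ⊆ Subset(X)`: open subsets and inclusions (FrdII App. p. 66) — Mathlib `Opens X`.
[cite: MochizukiFrdII2008, Appendix p.66] -/
abbrev OpenCat : Type u := Opens X

/-- `Closed(X) ⊆ Subset(X)`: closed subsets and inclusions (FrdII App. p. 66) — Mathlib `Closeds X`.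
[cite: MochizukiFrdII2008, Appendix p.66] -/
abbrev ClosedCat : Type u := Closeds X

/-- The object property "nonempty connected" on `Open(X)` (FrdII App. p. 66).
[cite: MochizukiFrdII2008, Appendix p.66] -/
def connectedOpens : ObjectProperty (Opens X) := fun U => IsConnected (U : Set X)

/-- `Open⁰(X) ⊆ Open(X)`: the full subcategory of [nonempty] connected open subsets (FrdII App. p. 66).
[cite: MochizukiFrdII2008, Appendix p.66] -/
abbrev Open0 : Type u := (connectedOpens X).FullSubcategory

/-- `Shv(X)`: sheaves of sets on `X` (FrdII App. p. 66) — Mathlib `TopCat.Sheaf (Type u) X`.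
[cite: MochizukiFrdII2008, Appendix p.66] -/
abbrev Shv : Type (u + 1) := TopCat.Sheaf (Type u) (TopCat.of X)

/-! ### Definition A.1 -/

/-- **Definition A.1 (i)**, local connectedness as printed (FrdII App. p. 66): "for every open subset
`U ⊆ X` and every point `x ∈ U`, there exists a connected open subset `V ⊆ U` such that `x ∈ V`."
[cite: MochizukiFrdII2008, Def A.1 (i) p.66] -/
@[mk_iff] structure IsLocallyConnected : Prop where
  /-- every point of an open set has a connected open neighbourhood inside it -/
  exists_connected : ∀ U : Set X, IsOpen U → ∀ x ∈ U,
    ∃ V : Set X, IsOpen V ∧ IsConnected V ∧ x ∈ V ∧ V ⊆ U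

/-- The printed local connectedness is Mathlib's `LocallyConnectedSpace`.
[cite: MochizukiFrdII2008, Def A.1 (i) p.66] -/
theorem isLocallyConnected_iff_locallyConnectedSpace :
    IsLocallyConnected X ↔ LocallyConnectedSpace X := by
  rw [isLocallyConnected_iff, locallyConnectedSpace_iff_subsets_isOpen_isConnected]
  constructor
  · intro h x U hU
    obtain ⟨W, hWU, hWo, hxW⟩ := mem_nhds_iff.mp hU
    obtain ⟨V, hVo, hVc, hxV, hVW⟩ := h W hWo x hxW
    exact ⟨V, hVW.trans hWU, hVo, hxV, hVc⟩
  · intro h U hU x hx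
    obtain ⟨V, hVU, hVo, hxV, hVc⟩ := h x U (hU.mem_nhds hx)
    exact ⟨V, hVo, hVc, hxV, hVU⟩

/-- **Definition A.1 (i)**, soberness as printed (FrdII App. p. 66): "for every irreducible closed
subset `F ⊆ X`, there exists a unique point `x ∈ F` such that `F` is equal to the closure of the
set `{x}` in `X`." [cite: MochizukiFrdII2008, Def A.1 (i) p.66] -/
@[mk_iff] structure IsSober : Prop where
  /-- irreducible closed subsets have a unique generic point -/
  existsUnique_generic : ∀ F : Set X, IsIrreducible F → IsClosed F →
    ∃! x : X, x ∈ F ∧ F = closure {x}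

/-- The printed soberness is Mathlib's `QuasiSober ∧ T0Space` (existence of generic points plus
their uniqueness). [cite: MochizukiFrdII2008, Def A.1 (i) p.66] -/
theorem isSober_iff_quasiSober : IsSober X ↔ QuasiSober X ∧ T0Space X := by
  constructor
  · intro h
    have hT0 : T0Space X := by
      rw [t0Space_iff_inseparable]
      intro x y hxy
      rw [inseparable_iff_closure_eq] at hxy
      obtain ⟨z, _, hz⟩ := h.existsUnique_generic (closure {x})
        isIrreducible_singleton.closure isClosed_closure
      have hx := hz x ⟨subset_closure (mem_singleton x), rfl⟩
      have hy := hz y ⟨hxy ▸ subset_closure (mem_singleton y), hxy⟩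
      exact hx.trans hy.symm
    refine ⟨⟨fun {S} hS hS' => ?_⟩, hT0⟩
    obtain ⟨x, ⟨_, hx⟩, _⟩ := h.existsUnique_generic S hS hS'
    exact ⟨x, hx.symm⟩
  · rintro ⟨hQ, hT⟩
    refine ⟨fun F hF hF' => ?_⟩
    obtain ⟨x, hx⟩ := QuasiSober.sober hF hF'
    refine ⟨x, ⟨hx.mem, hx.symm⟩, fun y hy => ?_⟩
    have : IsGenericPoint y F := hy.2.symm
    exact (this.inseparable hx).eq

variable {X}

/-- **Definition A.1 (ii)** (FrdII App. p. 66): a collection `{Aᵢ}_{i ∈ I}` of distinct objects of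
`Open⁰(X)` is a *collection of disjoint objects* if for distinct `i, j` "there does not exist an
object `C ∈ Ob(Open⁰(X))` that admits a morphism in `Open⁰(X)` to both `Aᵢ` and `Aⱼ`".
[cite: MochizukiFrdII2008, Def A.1 (ii) p.66] -/
def IsDisjointCollection {I : Type u} (A : I → Open0 X) : Prop :=
  Injective A ∧ ∀ ⦃i j : I⦄, i ≠ j → ∀ C : Open0 X, ¬ (Nonempty (C ⟶ A i) ∧ Nonempty (C ⟶ A j))

/-- An arrow `C → A` of `Open⁰(X)` is an inclusion `C ⊆ A`. [cite: MochizukiFrdII2008, Appendix p.66] -/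
theorem nonempty_hom_iff (C A : Open0 X) : Nonempty (C ⟶ A) ↔ (C.obj : Set X) ⊆ A.obj :=
  ⟨fun ⟨f⟩ => f.hom.le, fun h => ⟨ObjectProperty.homMk (homOfLE h)⟩⟩

/-- **Remark A.1.1** (FrdII App. p. 67): "if `X` is locally connected, then … the `Aᵢ` are disjoint if
and only if the open subsets of `X` to which the `Aᵢ` correspond are pair-wise mutually 'disjoint' in
the usual sense." [cite: MochizukiFrdII2008, Rmk A.1.1 p.67] -/
theorem isDisjointCollection_iff_pairwise_disjoint [LocallyConnectedSpace X] {I : Type u}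
    (A : I → Open0 X) (hA : Injective A) :
    IsDisjointCollection A ↔ Pairwise fun i j => Disjoint ((A i).obj : Set X) (A j).obj := by
  refine ⟨fun h i j hij => ?_, fun h => ⟨hA, fun i j hij C hC => ?_⟩⟩
  · change Disjoint ((A i).obj : Set X) (A j).obj
    rw [Set.disjoint_iff]
    rintro x ⟨hxi, hxj⟩
    have hU : IsOpen (((A i).obj : Set X) ∩ (A j).obj) := (A i).obj.isOpen.inter (A j).obj.isOpen
    obtain ⟨V, hVU, hVo, hxV, hVc⟩ :=
      locallyConnectedSpace_iff_subsets_isOpen_isConnected.mp inferInstance x _ (hU.mem_nhds ⟨hxi, hxj⟩)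
    let C : Open0 X := ⟨⟨V, hVo⟩, hVc⟩
    exact h.2 hij C ⟨(nonempty_hom_iff C (A i)).mpr fun y hy => (hVU hy).1,
      (nonempty_hom_iff C (A j)).mpr fun y hy => (hVU hy).2⟩
  · obtain ⟨hi, hj⟩ := hC
    rw [nonempty_hom_iff] at hi hj
    obtain ⟨x, hx⟩ := C.property.nonempty
    exact Set.disjoint_iff.mp (h hij) ⟨hi hx, hj hx⟩

variable (X)

/-- The object property cutting `Disjt(Open⁰(X))` out of the formal coproducts of `Open⁰(X)`:
collections of disjoint objects (FrdII App., Def. A.1 (iii), p. 66).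
[cite: MochizukiFrdII2008, Def A.1 (iii) p.66] -/
def disjt : ObjectProperty (Limits.FormalCoproduct.{u} (Open0 X)) := fun F => IsDisjointCollection F.obj

/-- **Definition A.1 (iii)** (FrdII App. p. 66): `Disjt(Open⁰(X))`, whose objects are collections of
disjoint objects `{Uᵢ}_{i ∈ I}` (`I` possibly empty) and whose arrows `{Uᵢ} → {Vⱼ}` are "a function
`f : I → J` and a collection of morphisms `Uᵢ → V_{f(i)}`" — the full subcategory of Mathlib's
`FormalCoproduct (Open⁰ X)` on `disjt X`. [cite: MochizukiFrdII2008, Def A.1 (iii) p.66] -/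
abbrev Disjt : Type (u + 1) := (disjt X).FullSubcategory

/-- A single object of `Open⁰(X)` is a collection of disjoint objects.
[cite: MochizukiFrdII2008, Def A.1 (iii) pp.66-67] -/
theorem disjt_incl (U : Open0 X) : disjt X ((Limits.FormalCoproduct.incl (Open0 X)).obj U) :=
  ⟨fun (a : PUnit) b _ => Subsingleton.elim a b,
    fun (a : PUnit) b hij => absurd (Subsingleton.elim a b) hij⟩

/-- The natural functor `Open⁰(X) → Disjt(Open⁰(X))`, "assigning to an object of `Open⁰(X)` the
collection … consisting of this single object" (FrdII App. pp. 66–67).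
[cite: MochizukiFrdII2008, Def A.1 (iii) pp.66-67] -/
def single : Open0 X ⥤ Disjt X :=
  ObjectProperty.lift _ (Limits.FormalCoproduct.incl (Open0 X)) (disjt_incl X)

/-- `Open⁰(X) → Disjt(Open⁰(X))` is full (FrdII App. p. 67: "easily verified to be fully
faithful"). [cite: MochizukiFrdII2008, Def A.1 (iii) p.67] -/
instance single_full : (single X).Full :=
  inferInstanceAs (ObjectProperty.lift _ (Limits.FormalCoproduct.incl (Open0 X)) (disjt_incl X)).Full

/-- `Open⁰(X) → Disjt(Open⁰(X))` is faithful (FrdII App. p. 67).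
[cite: MochizukiFrdII2008, Def A.1 (iii) p.67] -/
instance single_faithful : (single X).Faithful :=
  inferInstanceAs
    (ObjectProperty.lift _ (Limits.FormalCoproduct.incl (Open0 X)) (disjt_incl X)).Faithful

/-- `Open⁰(X) → Disjt(Open⁰(X))` "is easily verified to be fully faithful" (FrdII App. p. 67).
[cite: MochizukiFrdII2008, Def A.1 (iii) p.67] -/
noncomputable def singleFullyFaithful : (single X).FullyFaithful :=
  Functor.FullyFaithful.ofFullyFaithful (single X)

/-- The natural functor `Disjt(Open⁰(X)) → Open(X)`, assigning "to a collection `{Uᵢ}` the object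
of `Open(X)` constituted by the union of the connected open sets determined by the `Uᵢ`"
(FrdII App. p. 67). [cite: MochizukiFrdII2008, Def A.1 (iii) p.67] -/
def union : Disjt X ⥤ Opens X where
  obj F := ⨆ i, (F.obj.obj i).obj
  map {_ G} f := homOfLE (iSup_le fun i =>
    (f.hom.φ i).hom.le.trans (le_iSup (fun j => (G.obj.obj j).obj) (f.hom.f i)))
  map_id _ := Subsingleton.elim _ _
  map_comp _ _ := Subsingleton.elim _ _

/-! ### Theorem A.2 -/

/-- **Theorem A.2 (i)** (FrdII App. p. 67): "`Open(X)` is equivalent to the opposite category to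
`Closed(X)`" — by complements. [cite: MochizukiFrdII2008, Thm A.2 (i) p.67] -/
noncomputable def opensEquivClosedsOp : Opens X ≌ (Closeds X)ᵒᵖ :=
  (Opens.complOrderIso (α := X)).equivalence.trans (orderDualEquivalence (Closeds X))

variable {X} in
/-- A category all of whose hom-sets are subsingletons (e.g. any category of subsets and inclusions)
is slim: a natural automorphism of `C_A → C` has components in subsingletons. This is the argument
of FrdII App. p. 68 ("the categories in question have no nontrivial automorphisms").
[cite: MochizukiFrdII2008, Thm A.2 (ii) pp.67-68] -/
theorem isSlim_of_subsingleton_hom {C : Type*} [Category C] (h : ∀ a b : C, Subsingleton (a ⟶ b)) :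
    IsSlim C :=
  ⟨fun _ _ => Iso.ext (NatTrans.ext (funext fun _ => (h _ _).elim _ _))⟩

omit [TopologicalSpace X] in
/-- **Theorem A.2 (ii)** for `Subset(X)` (FrdII App. p. 67): `Subset(X)` is slim.
[cite: MochizukiFrdII2008, Thm A.2 (ii) p.67] -/
theorem isSlim_subsetCat : IsSlim (SubsetCat X) := isSlim_of_subsingleton_hom fun _ _ => inferInstance

/-- **Theorem A.2 (ii)** for `Open(X)` (FrdII App. p. 67): `Open(X)` is slim.
[cite: MochizukiFrdII2008, Thm A.2 (ii) p.67] -/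
theorem isSlim_openCat : IsSlim (OpenCat X) := isSlim_of_subsingleton_hom fun _ _ => inferInstance

/-- **Theorem A.2 (ii)** for `Closed(X)` (FrdII App. p. 67): `Closed(X)` is slim.
[cite: MochizukiFrdII2008, Thm A.2 (ii) p.67] -/
theorem isSlim_closedCat : IsSlim (ClosedCat X) := isSlim_of_subsingleton_hom fun _ _ => inferInstance

/-- **Theorem A.2 (ii)** for `Open⁰(X)` (FrdII App. p. 67): `Open⁰(X)` is slim.
[cite: MochizukiFrdII2008, Thm A.2 (ii) p.67] -/
theorem isSlim_open0 : IsSlim (Open0 X) :=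
  isSlim_of_subsingleton_hom fun _ _ =>
    ⟨fun _ _ => (ObjectProperty.ι (connectedOpens X)).map_injective (Subsingleton.elim _ _)⟩

/-- **Theorem A.2 (iii)** (FrdII App. p. 67), the sheaf part: the presheaf on `Open(X)` represented by
an open `U` (i.e. `V ↦ Hom(V, U)`) is a sheaf, so the Yoneda embedding — which is fully faithful
(Mathlib `yoneda`) — lands in `Shv(X)`. [cite: MochizukiFrdII2008, Thm A.2 (iii) p.67] -/
def ItemIII_representable_isSheaf : Prop :=
  ∀ U : Opens X, TopCat.Presheaf.IsSheaf (yoneda.obj U : TopCat.Presheaf (Type u) (TopCat.of X))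

/-- **Theorem A.2 (iii)**, Yoneda part: `Open(X) → [Open(X)ᵒᵖ, Set]` is fully faithful (Mathlib).
[cite: MochizukiFrdII2008, Thm A.2 (iii) p.67] -/
def yonedaOpensFullyFaithful : (yoneda (C := Opens X)).FullyFaithful := Yoneda.fullyFaithful

variable (Y : Type u) [TopologicalSpace Y]

/-- **Theorem A.2 (iv)** (FrdII App. p. 67): for sober `X`, `Y`, "passing to the induced equivalence on
the categories `Open(−)` determines a bijection between the equivalences of categories
`Open(X) ≃ Open(Y)` [considered up to isomorphism] and the homeomorphisms `X ≃ Y`": every equivalence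
agrees on objects with the one induced (`Homeomorph.opensCongr`) by a unique homeomorphism.
[cite: MochizukiFrdII2008, Thm A.2 (iv) p.67] -/
def ItemIV : Prop :=
  IsSober X → IsSober Y → ∀ e : Opens X ≌ Opens Y,
    ∃! h : X ≃ₜ Y, ∀ U : Opens X, e.functor.obj U = h.opensCongr U

/-- **Theorem A.2 (v)** (FrdII App. p. 67): "Suppose that `X` is locally connected. Then the natural
functor `Disjt(Open⁰(X)) → Open(X)` is an equivalence of categories" (every open is the disjoint
union of its connected components). [cite: MochizukiFrdII2008, Thm A.2 (v) p.67] -/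
def ItemV : Prop := LocallyConnectedSpace X → (union X).IsEquivalence

/-- **Theorem A.2 (vi)** (FrdII App. p. 67): for sober, locally connected `X`, `Y`, "passing to the
induced equivalence on the categories `Open⁰(−)` determines a bijection between the equivalences of
categories `Open⁰(X) ≃ Open⁰(Y)` [considered up to isomorphism] and the homeomorphisms `X ≃ Y`."
[cite: MochizukiFrdII2008, Thm A.2 (vi) p.67] -/
def ItemVI : Prop :=
  IsSober X → IsSober Y → LocallyConnectedSpace X → LocallyConnectedSpace Y →
    ∀ e : Open0 X ≌ Open0 Y,
      ∃! h : X ≃ₜ Y, ∀ U : Open0 X, (e.functor.obj U).obj = h.opensCongr U.obj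

/-- **Remark A.2.1**, first half (FrdII App. p. 68): a countably infinite space whose proper closed
subsets are exactly the finite subsets (e.g. the cofinite topology) is locally connected but not sober.
[cite: MochizukiFrdII2008, Rmk A.2.1 p.68] -/
def RmkA21_cofinite : Prop :=
  ∀ (Z : Type u) [TopologicalSpace Z], Countable Z → Infinite Z →
    (∀ F : Set Z, IsClosed F ↔ F = univ ∨ F.Finite) → LocallyConnectedSpace Z ∧ ¬ IsSober Z

/-- **Remark A.2.1**, second half (FrdII App. p. 68): an infinite profinite set (compact, Hausdorff,
totally disconnected) is sober but not locally connected. [cite: MochizukiFrdII2008, Rmk A.2.1 p.68] -/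
def RmkA21_profinite : Prop :=
  ∀ (Z : Type u) [TopologicalSpace Z], CompactSpace Z → T2Space Z → TotallyDisconnectedSpace Z →
    Infinite Z → IsSober Z ∧ ¬ LocallyConnectedSpace Z

end TopRep

end Literature.AlgebraicGeometry.Frobenioids
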